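import Summits.KontsevichZagierPeriods.KontsevichZagierPeriods.Theorems.SoloBlindZetaTwoSquare
import Literature.NumberTheory.Transcendental.GelfondSchneiderProofs
import HarnessLib

/-!
# Homogeneous sectors: KZ for the degree-`k` forms in `π` and `log μ`

The sectors of `Q = FormalRep/relations` decided so far are a polynomial ring in ONE period
(`x_π`, or one `ℓ(μ)`), the `ℚ̄`-span of dimension-`≤ 1` cells, and `ℚ`-lines.  Two
algebraically independent periods are out of reach (Schanuel), and even the three numbers
`π², π·log μ, log² μ` are not known to be `ℚ̄`-linearly independent of `1` (four exponentials
territory).  This file finds the sharp intermediate.  By **Gelfond–Schneider**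
(`gelfond_schneider_holds`, proved in the tree) the ratio `iπ / log μ` of the two logarithms
`log(-1) = iπ` and `log μ` is not algebraic irrational; being non-real it is not rational; so

* `transcendental_pi_div_log` — `π / log μ` is transcendental for real algebraic `μ > 0`,
  `μ ≠ 1`;

and ONE transcendental ratio is exactly what makes every space of HOMOGENEOUS forms of a fixed
degree `k` in `(π, log μ)` evaluation-injective (dehomogenise: a relation is
`log^k μ · p(π / log μ) = 0`):

* `linearIndependent_monomials` — `x^a y^(k-a)` (`a = 0..k`) are `K₀`-linearly independent
  (`K₀ = ℚ̄ ∩ ℝ`) as soon as `y ≠ 0` and `x / y` is transcendental;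
* `modSector g` — the `K₀`-linear sector of a finite family of classes, with
  `modSector_kernel` / `kz_modSector`: KZ holds on it when the values are `K₀`-independent;
* `homSector μ k := modSector (a ↦ x_π ^ a · ℓ(μ) ^ (k - a))` and **`kz_homSector`**: the
  Kontsevich–Zagier conjecture holds for every pair of integral representations whose classes
  are homogeneous degree-`k` forms over `ℚ̄ ∩ ℝ` in `x_π` and `ℓ(μ)`, for every `k` and every
  real algebraic `μ > 1`.

Instances in degree `2`: Kontsevich–Zagier's `ζ(2)`-representation `Z` (via
`six_smul_mkQ_zetaTwoRep : 6·[Z] = x_π²`, read off from the landed cell calculus), the unit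
square `S`, the Fubini squares `ℓ × ℓ` (value `log² μ`), and the mixed products
`A(1;1) × L(1;μ)` (value `(π/4)·log μ`); `kz_homSector_zetaTwo` is the sample corollary.
Euler's dilogarithm value `Li₂(1/2) = π²/12 - log²2/2` joins `H₂(2)` in `SoloBlindDilog`.

No new axioms: Gelfond–Schneider is a theorem of the tree.
-/

noncomputable section

namespace Summit.KontsevichZagierPeriods.KontsevichZagierPeriods.Theorems

open Set MeasureTheory
open Literature.NumberTheory.Transcendental
open Literature.NumberTheory.Transcendental.KZ

namespace SoloBlind

/-! ## Gelfond–Schneider ⇒ `π / log μ` is transcendental -/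

/-- **`π / log μ ∉ ℚ̄`** for a real algebraic `μ > 0`, `μ ≠ 1`.  If `π / log μ` were an
algebraic `τ`, then `b = iτ` is algebraic and not rational (it is not real), `e^{log μ} = μ`
is algebraic, and Gelfond–Schneider makes `e^{b·log μ} = e^{iπ} = -1` transcendental —
absurd. -/
theorem transcendental_pi_div_log {μ : ℝ} (hμ : IsAlgebraic ℚ μ) (h0 : 0 < μ) (h1 : μ ≠ 1) :
    Transcendental ℚ (Real.pi / Real.log μ) := by
  have hL : Real.log μ ≠ 0 := Real.log_ne_zero_of_pos_of_ne_one h0 h1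
  intro hτ
  have hI : IsAlgebraic ℚ Complex.I :=
    IsAlgebraic.of_pow two_pos (by rw [Complex.I_sq]; exact isAlgebraic_one.neg)
  set β : ℂ := ((Real.pi / Real.log μ : ℝ) : ℂ) * Complex.I with hβdef
  have hβ : IsAlgebraic ℚ β := (hτ.algebraMap (A := ℂ)).mul hI
  have hβq : β ∉ Set.range ((↑) : ℚ → ℂ) := by
    rintro ⟨q, hq⟩
    have h := congrArg Complex.im hq
    simp only [hβdef, Complex.ratCast_im, Complex.mul_im, Complex.ofReal_re, Complex.I_im,
      mul_one, Complex.ofReal_im, Complex.I_re, mul_zero, add_zero] at h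
    exact div_ne_zero Real.pi_ne_zero hL h.symm
  have hexp : Complex.exp ((Real.log μ : ℝ) : ℂ) = (μ : ℂ) := by
    rw [← Complex.ofReal_exp, Real.exp_log h0]
  have key : β * (Real.log μ : ℂ) = Real.pi * Complex.I := by
    rw [hβdef, mul_right_comm, ← Complex.ofReal_mul, div_mul_cancel₀ _ hL]
  have hT := gelfond_schneider_holds (hμ.algebraMap (A := ℂ)) hβ hβq hexp
    (Complex.ofReal_ne_zero.mpr hL)
  rw [key, Complex.exp_pi_mul_I] at hT
  exact hT isAlgebraic_one.neg

/-! ## `K₀`-linear sectors -/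

variable {ι : Type}

/-- The `K₀`-linear sector of a finite family of classes `g : ι → Q`: the formal combinations
whose class lies in the `K₀`-span of the `gᵢ` (`K₀ = ℚ̄ ∩ ℝ`). -/
def modSector (g : ι → Q) : AddSubgroup FormalRep where
  carrier := {z | mkQ z ∈ Submodule.span K₀ (Set.range g)}
  zero_mem' := by simp
  add_mem' {a b} ha hb := by
    simp only [mem_setOf_eq, map_add] at ha hb ⊢
    exact add_mem ha hb
  neg_mem' {a} ha := by
    simp only [mem_setOf_eq, map_neg] at ha ⊢
    exact neg_mem ha

/-- Membership in a `K₀`-linear sector. -/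
theorem mem_modSector {g : ι → Q} {z : FormalRep} :
    z ∈ modSector g ↔ mkQ z ∈ Submodule.span K₀ (Set.range g) := Iff.rfl

/-- Every relation lies in every sector. -/
theorem relations_le_modSector (g : ι → Q) {z : FormalRep} (hz : z ∈ relations) :
    z ∈ modSector g := by
  rw [mem_modSector, mkQ_eq_zero_iff.mpr hz]
  exact zero_mem _

/-- A `K₀`-multiple of one generator lies in the sector. -/
theorem mem_modSector_of_mkQ_eq {g : ι → Q} {z : FormalRep} (i : ι) (β : K₀)
    (h : mkQ z = β • g i) : z ∈ modSector g := by
  rw [mem_modSector, h]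
  exact Submodule.smul_mem _ _ (Submodule.subset_span (mem_range_self i))

/-- Sector membership only depends on the class: it transports along equivalences. -/
theorem mem_modSector_of_equivalent {g : ι → Q} {n m : ℕ} {r : IntegralRep n}
    {r' : IntegralRep m} (h : Equivalent r r') (hr' : of r' ∈ modSector g) :
    of r ∈ modSector g := by
  rw [mem_modSector, mkQ_eq_mkQ_iff.mpr h]
  exact mem_modSector.mp hr'

/-- **Kernel form.** If the values `evalQ gᵢ` are linearly independent over `K₀`, an element
of the sector with period `0` is a relation. -/
theorem modSector_kernel [Fintype ι] {g : ι → Q}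
    (hg : LinearIndependent K₀ fun i => evalQ (g i))
    {z : FormalRep} (hz : z ∈ modSector g) (h0 : eval z = 0) : z ∈ relations := by
  classical
  obtain ⟨c, hc⟩ := (Submodule.mem_span_range_iff_exists_fun K₀).mp (mem_modSector.mp hz)
  have hsum : ∑ i, c i • evalQ (g i) = 0 := by
    have h := congrArg evalQ hc
    rw [map_sum, evalQ_mkQ, h0] at h
    simpa only [evalQ_smul, IntermediateField.smul_def, smul_eq_mul] using h
  have hc0 : ∀ i, c i = 0 := Fintype.linearIndependent_iff.mp hg c hsum
  refine mkQ_eq_zero_iff.mp ?_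
  rw [← hc]
  simp [hc0]

/-- **KZ on a `K₀`-linear sector.** -/
theorem kz_modSector [Fintype ι] {g : ι → Q} (hg : LinearIndependent K₀ fun i => evalQ (g i))
    {n m : ℕ} (r : IntegralRep n) (r' : IntegralRep m) (hr : of r ∈ modSector g)
    (hr' : of r' ∈ modSector g) (hv : r.value = r'.value) : Equivalent r r' := by
  refine mkQ_eq_mkQ_iff.mp (sub_eq_zero.mp ?_)
  rw [← map_sub]
  refine mkQ_eq_zero_iff.mpr (modSector_kernel hg (sub_mem hr hr') ?_)
  rw [map_sub, eval_of, eval_of, hv, sub_self]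

/-! ## Homogeneous monomials in two periods with transcendental ratio -/

/-- Powers `τ^0, …, τ^k` of a transcendental real are `K₀`-linearly independent. -/
theorem linearIndependent_pow_of_transcendental {τ : ℝ} (hτ : Transcendental ℚ τ) (k : ℕ) :
    LinearIndependent K₀ fun a : Fin (k + 1) => τ ^ (a : ℕ) := by
  classical
  have hT : Transcendental K₀ τ := transcendental_K₀ hτ
  refine Fintype.linearIndependent_iff.mpr fun c hc a => ?_
  let p : Polynomial K₀ := ∑ b : Fin (k + 1), Polynomial.C (c b) * Polynomial.X ^ (b : ℕ)
  have hp : Polynomial.aeval τ p = 0 := by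
    simp only [p, map_sum, map_mul, map_pow, Polynomial.aeval_C, Polynomial.aeval_X,
      IntermediateField.algebraMap_apply]
    simpa only [IntermediateField.smul_def, smul_eq_mul] using hc
  have hp0 : p = 0 := (transcendental_iff.mp hT) p hp
  have hcoeff : p.coeff a = c a := by
    simp only [p, Polynomial.finsetSum_coeff, Polynomial.coeff_C_mul_X_pow, Fin.val_inj]
    simp
  rw [← hcoeff, hp0, Polynomial.coeff_zero]

/-- **Homogeneous monomials are independent.** If `y ≠ 0` and `x / y` is transcendental, the
monomials `x^a · y^(k-a)` (`a = 0, …, k`) are `K₀`-linearly independent: a relation is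
`y^k · p(x/y) = 0` for a polynomial `p` over `K₀` of degree `≤ k`. -/
theorem linearIndependent_monomials {x y : ℝ} (hy : y ≠ 0) (hτ : Transcendental ℚ (x / y))
    (k : ℕ) : LinearIndependent K₀ fun a : Fin (k + 1) => x ^ (a : ℕ) * y ^ (k - (a : ℕ)) := by
  have h := (linearIndependent_pow_of_transcendental hτ k).map' (LinearMap.mulLeft K₀ (y ^ k))
    (LinearMap.ker_eq_bot.mpr (mul_right_injective₀ (pow_ne_zero k hy)))
  have hfun : (fun a : Fin (k + 1) => x ^ (a : ℕ) * y ^ (k - (a : ℕ))) =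
      LinearMap.mulLeft K₀ (y ^ k) ∘ fun a : Fin (k + 1) => (x / y) ^ (a : ℕ) := by
    funext a
    have ha : (a : ℕ) ≤ k := Nat.lt_succ_iff.mp a.2
    rw [Function.comp_apply, LinearMap.mulLeft_apply, div_pow, pow_sub₀ _ hy ha]
    field_simp
  rw [hfun]
  exact h

/-! ## The homogeneous sectors `H_k(μ)` -/

/-- The degree-`k` monomial classes `x_π ^ a · ℓ(μ) ^ (k - a)`, `a = 0, …, k`. -/
def homGen (μ : ℝ) (k : ℕ) (a : Fin (k + 1)) : Q := xPi ^ (a : ℕ) * ell μ ^ (k - (a : ℕ))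

/-- Values of the monomial classes. -/
theorem evalQ_homGen {μ : ℝ} (hμ : IsAlgebraic ℚ μ) (h1 : 1 ≤ μ) (k : ℕ) (a : Fin (k + 1)) :
    evalQ (homGen μ k a) = Real.pi ^ (a : ℕ) * Real.log μ ^ (k - (a : ℕ)) := by
  rw [homGen, map_mul, map_pow, map_pow, evalQ_xPi, evalQ_ell hμ h1]

/-- **The homogeneous sector** `H_k(μ)`: formal combinations whose class is a homogeneous
degree-`k` form in `x_π` and `ℓ(μ)` with coefficients in `K₀ = ℚ̄ ∩ ℝ`. -/
abbrev homSector (μ : ℝ) (k : ℕ) : AddSubgroup FormalRep := modSector (homGen μ k)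

/-- The values of the generators of `H_k(μ)` are `K₀`-independent (Gelfond–Schneider). -/
theorem linearIndependent_evalQ_homGen {μ : ℝ} (hμ : IsAlgebraic ℚ μ) (h1 : 1 < μ) (k : ℕ) :
    LinearIndependent K₀ fun a => evalQ (homGen μ k a) := by
  have h := linearIndependent_monomials (Real.log_pos h1).ne'
    (transcendental_pi_div_log hμ (by linarith) h1.ne') k
  convert h using 1
  funext a
  exact evalQ_homGen hμ h1.le k a

/-- **Kernel form: KZ on the homogeneous sector.** An element of `H_k(μ)` with period `0`
is a relation. -/
theorem homSector_kernel {μ : ℝ} (hμ : IsAlgebraic ℚ μ) (h1 : 1 < μ) {k : ℕ} {z : FormalRep}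
    (hz : z ∈ homSector μ k) (h0 : eval z = 0) : z ∈ relations :=
  modSector_kernel (linearIndependent_evalQ_homGen hμ h1 k) hz h0

/-- **The Kontsevich–Zagier conjecture holds on every homogeneous sector `H_k(μ)`**
(`μ > 1` real algebraic): two integral representations whose classes are homogeneous
degree-`k` forms over `ℚ̄ ∩ ℝ` in `x_π, ℓ(μ)` and whose periods agree are connected by the
three moves. -/
theorem kz_homSector {μ : ℝ} (hμ : IsAlgebraic ℚ μ) (h1 : 1 < μ) {k n m : ℕ}
    (r : IntegralRep n) (r' : IntegralRep m) (hr : of r ∈ homSector μ k)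
    (hr' : of r' ∈ homSector μ k) (hv : r.value = r'.value) : Equivalent r r' :=
  kz_modSector (linearIndependent_evalQ_homGen hμ h1 k) r r' hr hr' hv

/-! ## Degree two: `ζ(2)`, squares of logarithms, and `π · log μ` -/

/-- The class of KZ's `P = [(0,∞), dx/(1+x²)]` is `2·a(1)`: both lie in the cell span and have
value `π/2`. -/
theorem mkQ_arctanHalfLine : mkQ (of arctanHalfLine) = (2 : K₀) • alpha 1 := by
  refine sub_eq_zero.mp (eq_zero_of_mem_cellSpan (sub_mem
    (mkQ_of_mem_cellSpan arctanHalfLine le_rfl isRational_arctanHalfLine)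
    (Submodule.smul_mem _ _ (alpha_mem_cellSpan isAlgebraic_one one_pos))) ?_)
  rw [map_sub, evalQ_mkQ, eval_of, arctanHalfLine_value, evalQ_smul,
    evalQ_alpha isAlgebraic_one zero_le_one, Real.arctan_one]
  have h2 : ((2 : K₀) : ℝ) = 2 := by norm_cast
  rw [h2]
  ring

/-- **`6·[Z] = x_π²`** in `Q`: Kontsevich–Zagier's `ζ(2) = π²/6` as an identity of classes. -/
theorem six_smul_mkQ_zetaTwoRep : (6 : K₀) • mkQ (of zetaTwoRep) = xPi ^ 2 := by
  have h3 : (3 : K₀) • mkQ (of zetaTwoRep) =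
      2 • (mkQ (of arctanHalfLine) * mkQ (of arctanHalfLine)) := by
    rw [ofNat_smul_eq_nsmul K₀]
    exact three_smul_mkQ_zetaTwoRep
  rw [show (6 : K₀) = 2 * 3 by norm_num, mul_smul, h3, mkQ_arctanHalfLine, xPi]
  rw [ofNat_smul_eq_nsmul K₀ 2 (alpha 1), ofNat_smul_eq_nsmul K₀ 4 (alpha 1),
    ofNat_smul_eq_nsmul K₀ 2]
  simp only [nsmul_eq_mul, Nat.cast_ofNat]
  ring

/-- `Z ∈ H₂(μ)`: `[Z] = 6⁻¹ · x_π²`. -/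
theorem of_zetaTwoRep_mem_homSector (μ : ℝ) : of zetaTwoRep ∈ homSector μ 2 := by
  refine mem_modSector_of_mkQ_eq (Fin.last 2) (6 : K₀)⁻¹ ?_
  rw [homGen, eq_inv_smul_iff₀ (by norm_num : (6 : K₀) ≠ 0), six_smul_mkQ_zetaTwoRep]
  simp

/-- The unit square `S = [(0,1)², 1/(1-xy)] ∈ H₂(μ)`. -/
theorem of_unitSquareRep_mem_homSector (μ : ℝ) : of unitSquareRep ∈ homSector μ 2 :=
  mem_modSector_of_equivalent equivalent_unitSquare_zetaTwo (of_zetaTwoRep_mem_homSector μ)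

/-- The Fubini square `L(1;μ) × L(1;μ)` (value `log² μ`) lies in `H₂(μ)`. -/
theorem of_logCell_prod_mem_homSector {μ : ℝ} (hμ : IsAlgebraic ℚ μ) :
    of ((logCell 1 μ isAlgebraic_one hμ).prod (logCell 1 μ isAlgebraic_one hμ)) ∈
      homSector μ 2 := by
  refine mem_modSector_of_mkQ_eq 0 1 ?_
  rw [← of_mul_of, mkQ_mul, ← ell_eq hμ, one_smul, homGen]
  simp [sq]

/-- The mixed product `A(1;1) × L(1;μ)` (value `(π/4)·log μ`) lies in `H₂(μ)`. -/
theorem of_atanCell_prod_logCell_mem_homSector {μ : ℝ} (hμ : IsAlgebraic ℚ μ) :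
    of ((atanCell 1 1 isAlgebraic_one isAlgebraic_one).prod (logCell 1 μ isAlgebraic_one hμ)) ∈
      homSector μ 2 := by
  refine mem_modSector_of_mkQ_eq 1 (4 : K₀)⁻¹ ?_
  rw [← of_mul_of, mkQ_mul, ← ell_eq hμ, ← alpha_eq isAlgebraic_one, homGen, xPi]
  rw [eq_inv_smul_iff₀ (by norm_num : (4 : K₀) ≠ 0)]
  simp

/-- Value of the mixed product: `(π/4) · log μ`. -/
theorem atanCell_prod_logCell_value {μ : ℝ} (hμ : IsAlgebraic ℚ μ) (h1 : 1 ≤ μ) :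
    ((atanCell 1 1 isAlgebraic_one isAlgebraic_one).prod
      (logCell 1 μ isAlgebraic_one hμ)).value = Real.pi / 4 * Real.log μ := by
  rw [IntegralRep.value_prod, value_atanCell zero_le_one, value_logCell h1, Real.arctan_one]
  ring

/-- **KZ, degree two, sample.** Any integral representation in `H₂(μ)` with period `π²/6` is
equivalent to Kontsevich–Zagier's `Z` — e.g. every `K₀`-combination of `S`, `ℓ × ℓ` and
`A × L` that happens to evaluate to `ζ(2)`. -/
theorem kz_homSector_zetaTwo {μ : ℝ} (hμ : IsAlgebraic ℚ μ) (h1 : 1 < μ) {m : ℕ}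
    (r' : IntegralRep m) (hr' : of r' ∈ homSector μ 2) (hv : r'.value = Real.pi ^ 2 / 6) :
    Equivalent zetaTwoRep r' :=
  kz_homSector hμ h1 zetaTwoRep r' (of_zetaTwoRep_mem_homSector μ) hr'
    (by rw [zetaTwoRep_value, hv])

end SoloBlind

end Summit.KontsevichZagierPeriods.KontsevichZagierPeriods.Theorems
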